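import Summits.KontsevichZagierPeriods.Zeta5Search.Barrier.ConeGammaCritBoxMiranda

/-!
# ζ(5) search — BARRIER: CRITICAL VALUES ON BOXES — soundness III: the affine value forms and the far-chart
# cancellation

HONEST FRAMING (cell `pub-zeta5`): systematic search; no irrationality claim unless kernel-certified. Theorems only,
about the computable checker of `ConeGammaCritBox`: the affine atoms enclose the box point, the twelve argument forms
enclose the twelve arguments of the growth functional (`critFactors_aOfS`) — in the far chart their NUMERATORS —,
`logSum` encloses sums of `c·log|x|` and certifies `x ≠ 0`; the growth functional as the (12 + 7)-term sum in the near
chart (`growthLogR_near`) and in the FAR chart (`yExponents_sum_eq_zero`: the seven `y`-exponents sum to zero, so the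
`log|Z|` parts cancel identically — `growthLogR_far`); `critFactors_near`, `critFactors_far_ne_zero`. MODEL objects
(BZ's growth functional `growthLogR_aOfS`) under BZ (28)+(30). Nothing about any γ of record,
C2 (OPEN), S-E or `ζ(5)`. Theory seat cert-2 g37.
-/

noncomputable section

open Set

namespace Summit.KontsevichZagierPeriods.Zeta5Search.Barrier.ConeGamma

namespace CritBox

open Literature.Analysis.ValidatedNumerics (AForm)
open Literature.Analysis.ValidatedNumerics.AForm
open LemmaFBox (SC SC_pos)

variable {ε : ℕ → ℝ}

/-! ### Atoms -/

/-- `linAF` encloses `(c + lin ε a)/den`. -/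
theorem linAF_mem (hε : Valid ε) (c : ℤ) (a : List ℤ) {den : ℕ} (hden : 0 < den) :
    mem SC ε (((c : ℝ) + lin ε a) / den) (linAF c a den) := by
  unfold mem linAF
  have hd : (0 : ℝ) < den := by exact_mod_cast hden
  have hc := abs_ediv_sub_le den (c * (SC : ℤ)) (t := (c : ℝ) * SC / den) (by push_cast; ring)
  have hl := abs_lin_map_sub_le (g := fun b : ℤ => b * (SC : ℤ) / den) (t := (SC : ℝ) / den)
    (fun b => by
      have := abs_ediv_sub_le den (b * (SC : ℤ)) (t := (SC : ℝ) / den * b) (by push_cast; ring)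
      simpa using this) hε a
  have e : ((c : ℝ) + lin ε a) / den * SC - ((c * (SC : ℤ) / den : ℤ) + lin ε (a.map fun b => b * (SC : ℤ) / den))
      = ((c : ℝ) * SC / den - ((c * (SC : ℤ) / den : ℤ) : ℝ)) + ((SC : ℝ) / den * lin ε a - lin ε (a.map fun b => b * (SC : ℤ) / den)) := by
    field_simp; ring
  rw [e]; push_cast
  refine (abs_add_le _ _).trans ?_
  rw [abs_sub_comm] at hc hl
  linarith

/-- `tAF` encloses `t_i` at the noise of the box point (`t₀ = 1`, open-box box). -/
theorem tAF_mem {D : ℕ} {lo hi : List ℕ} {t : Fin 8 → ℝ} (hok : boxOKc D lo hi = true)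
    (h : t ∈ LemmaFBox.box D lo hi) (ht0 : t 0 = 1) {η₁ η₂ : ℝ} (h1 : |η₁| ≤ 1) (h2 : |η₂| ≤ 1) (i : Fin 8) :
    mem SC (noise D lo hi t η₁ η₂) (t i) (tAF D lo hi i) := by
  have hv := valid_noise hok h h1 h2
  simp only [boxOKc, decide_eq_true_eq] at hok
  obtain ⟨hD, _, _, _, _, hall⟩ := hok
  have hlt : ∀ j : Fin 7, lo.getD (j.val + 1) 0 < hi.getD (j.val + 1) 0 := fun j => by
    have := hall j.val (List.mem_range.2 j.isLt); exact this.2.1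
  have key : ∀ j : Fin 8, j ≠ 0 → noise D lo hi t η₁ η₂ j = boxNoise D lo hi t j → lo.getD j 0 < hi.getD j 0 →
      mem SC (noise D lo hi t η₁ η₂) (t j) (tAF D lo hi j) := by
    intro j hj hn hl
    rw [tAF, if_neg hj]
    have hm := linAF_mem hv ((lo.getD j 0 : ℤ) + (hi.getD j 0 : ℤ))
      (List.replicate j 0 ++ [(hi.getD j 0 : ℤ) - (lo.getD j 0 : ℤ)]) (den := 2 * D) (by omega)
    rw [lin_replicate_append, hn, boxNoise] at hm
    have hd : (0 : ℝ) < ((hi.getD j 0 : ℕ) : ℝ) - ((lo.getD j 0 : ℕ) : ℝ) := by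
      have : ((lo.getD j 0 : ℕ) : ℝ) < ((hi.getD j 0 : ℕ) : ℝ) := by exact_mod_cast hl
      linarith
    have hD' : (0 : ℝ) < D := by exact_mod_cast hD
    convert hm using 1
    push_cast; field_simp; ring
  fin_cases i
  · simp only [tAF, Fin.zero_eta, if_true, Fin.isValue]
    rw [show t 0 = ((SC : ℤ) : ℝ) / SC by rw [ht0]; push_cast; exact (div_self (by exact_mod_cast SC_pos.ne')).symm]
    exact mem_const SC_pos _
  · exact key 1 (by decide) rfl (hlt 0)
  · exact key 2 (by decide) rfl (hlt 1)
  · exact key 3 (by decide) rfl (hlt 2)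
  · exact key 4 (by decide) rfl (hlt 3)
  · exact key 5 (by decide) rfl (hlt 4)
  · exact key 6 (by decide) rfl (hlt 5)
  · exact key 7 (by decide) rfl (hlt 6)

/-- `coordAF … 8` / `… 9` encloses the box coordinate with free noise `ε₈` / `ε₉`. -/
theorem coordAF_mem (hε : Valid ε) (c : ℤ) (a : List ℤ) (w : ℕ) {Q : ℕ} (hQ : 0 < Q) (k : ℕ) (hk : k = 8 ∨ k = 9) :
    mem SC ε (coordR c a w (ε k) Q ε) (coordAF c a w k Q) := by
  unfold coordAF coordR
  have hr : List.range 9 = [0, 1, 2, 3, 4, 5, 6, 7, 8] := by rfl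
  have hm := linAF_mem hε c
    (0 :: ((List.range 9).map fun j => if j + 1 = k then (w : ℤ) else if j < 7 then a.getD j 0 else 0)) hQ
  convert hm using 2
  rcases hk with rfl | rfl <;> simp [hr, lin, linR] <;> ring

/-! ### Sums of logarithms -/

/-- If `logSum` succeeds on a list of (coefficient, argument) forms enclosing `(c_k, x_k)`, then every `x_k ≠ 0` and
`Σ c_k log|x_k|` (right-nested) is enclosed. -/
theorem logSum_mem (hε : Valid ε) :
    ∀ (L : List (AForm × AForm)) (R : List (ℝ × ℝ)) (_ : List.Forall₂ (fun r F => mem SC ε r.1 F.1 ∧ mem SC ε r.2 F.2) R L)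
      {G : AForm} (_ : logSum L = some G),
      (∀ r ∈ R, r.2 ≠ 0) ∧ mem SC ε ((R.map fun r => r.1 * Real.log |r.2|).sum) G := by
  intro L
  induction L with
  | nil =>
    intro R hR G hG
    cases hR
    simp only [logSum, Option.some.injEq] at hG
    subst hG
    refine ⟨by simp, ?_⟩
    simpa using mem_const (ε := ε) SC_pos 0
  | cons F L ih =>
    intro R hR G hG
    cases hR with
    | cons hrF hRL =>
      rename_i r R'
      simp only [logSum] at hG
      split at hG
      · rename_i Lg Rg hL hRg
        simp only [Option.some.injEq] at hG
        subst hG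
        obtain ⟨hne, hmem⟩ := AFormLog.mem_logAbs SC_pos hε hL hrF.2
        obtain ⟨hall, hrest⟩ := ih R' hRL hRg
        refine ⟨?_, ?_⟩
        · intro r' hr'
          simp only [List.mem_cons] at hr'
          rcases hr' with rfl | hr'
          · exact hne
          · exact hall r' hr'
        · simp only [List.map_cons, List.sum_cons]
          exact mem_add (mem_mul SC_pos hε hrF.1 hmem) hrest
      · exact absurd hG (by simp)

/-! ### The growth functional -/

/-- The twelve coefficients `e_k` of `growthLogR_aOfS`, as reals. -/
def coefsR (t : Fin 8 → ℝ) : List ℝ :=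
  [t 4 + t 6, t 3 + t 6, t 5 + t 6, t 0 + t 6, -(t 0 + t 6), -(t 3 + t 4 + (t 5 + t 6)), -2 * t 6, t 6 + t 7,
   t 2 + t 6, t 1 + t 6, -(t 1 + t 2 + (t 6 + t 7)), -(t 0 + t 6)]

/-- The twelve arguments in the near chart. -/
def argsNearR (t : Fin 8 → ℝ) (X Y : ℝ) : List ℝ :=
  [X - t 4, X - t 3, X - t 5, X + Y + (t 6 - t 0), t 0 - X, t 3 + t 4 + t 5 - X, X + Y, Y - t 7, Y - t 2, Y - t 1,
   t 1 + t 2 + t 7 - Y, t 0 - Y]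

/-- The twelve numerators in the far chart. -/
def argsFarR (t : Fin 8 → ℝ) (X Z : ℝ) : List ℝ :=
  [X - t 4, X - t 3, X - t 5, X * Z + 1 + (t 6 - t 0) * Z, t 0 - X, t 3 + t 4 + t 5 - X, X * Z + 1, 1 - t 7 * Z,
   1 - t 2 * Z, 1 - t 1 * Z, (t 1 + t 2 + t 7) * Z - 1, t 0 * Z - 1]

/-- The seven constant (coefficient, argument) pairs. -/
def constTermsR (t : Fin 8 → ℝ) : List (ℝ × ℝ) :=
  [(t 0 - t 3, t 0 - t 3), (t 3 + t 4, t 3 + t 4), (t 1 + t 2, t 1 + t 2), (t 0 - t 2, t 0 - t 2),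
   (-(t 4 + t 6), t 4 + t 6), (-(t 0 - t 6), t 0 - t 6), (-(t 1 + t 6), t 1 + t 6)]

section Mem
variable {tA : Fin 8 → AForm} {t : Fin 8 → ℝ} {XA VA : AForm} {X V : ℝ}

/-- The coefficient forms enclose the coefficients. -/
theorem coefs_forall₂ (ht : ∀ i, mem SC ε (t i) (tA i)) :
    List.Forall₂ (fun r F => mem SC ε r F) (coefsR t) (coefs tA) := by
  simp only [coefsR, coefs]
  refine List.Forall₂.cons (mem_add (ht 4) (ht 6)) (.cons (mem_add (ht 3) (ht 6)) (.cons (mem_add (ht 5) (ht 6))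
    (.cons (mem_add (ht 0) (ht 6)) (.cons (mem_neg (mem_add (ht 0) (ht 6)))
    (.cons (mem_neg (mem_add (mem_add (ht 3) (ht 4)) (mem_add (ht 5) (ht 6)))) (.cons ?_
    (.cons (mem_add (ht 6) (ht 7)) (.cons (mem_add (ht 2) (ht 6)) (.cons (mem_add (ht 1) (ht 6))
    (.cons (mem_neg (mem_add (mem_add (ht 1) (ht 2)) (mem_add (ht 6) (ht 7)))) (.cons (mem_neg (mem_add (ht 0) (ht 6)))
    .nil)))))))))))
  have := mem_mulInt (-2) (ht 6); push_cast at this; exact this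

/-- The near-chart argument forms enclose the arguments. -/
theorem argsNear_forall₂ (ht : ∀ i, mem SC ε (t i) (tA i)) (hX : mem SC ε X XA) (hV : mem SC ε V VA) :
    List.Forall₂ (fun r F => mem SC ε r F) (argsNearR t X V) (argsNear tA XA VA) := by
  simp only [argsNearR, argsNear]
  exact .cons (mem_sub hX (ht 4)) (.cons (mem_sub hX (ht 3)) (.cons (mem_sub hX (ht 5))
    (.cons (mem_add (mem_add hX hV) (mem_sub (ht 6) (ht 0))) (.cons (mem_sub (ht 0) hX)
    (.cons (mem_sub (mem_add (mem_add (ht 3) (ht 4)) (ht 5)) hX) (.cons (mem_add hX hV) (.cons (mem_sub hV (ht 7))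
    (.cons (mem_sub hV (ht 2)) (.cons (mem_sub hV (ht 1)) (.cons (mem_sub (mem_add (mem_add (ht 1) (ht 2)) (ht 7)) hV)
    (.cons (mem_sub (ht 0) hV) .nil)))))))))))

/-- The far-chart argument forms enclose the numerators. -/
theorem argsFar_forall₂ (hε : Valid ε) (ht : ∀ i, mem SC ε (t i) (tA i)) (hX : mem SC ε X XA) (hV : mem SC ε V VA) :
    List.Forall₂ (fun r F => mem SC ε r F) (argsFarR t X V) (argsFar tA XA VA) := by
  have h1 : mem SC ε (1 : ℝ) (const (SC : ℤ)) := by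
    have := mem_const (ε := ε) SC_pos (SC : ℤ)
    rwa [show (((SC : ℤ) : ℝ)) / SC = 1 by push_cast; exact div_self (by exact_mod_cast SC_pos.ne')] at this
  have hXZ1 : mem SC ε (X * V + 1) (add (mul SC XA VA) (const (SC : ℤ))) := mem_add (mem_mul SC_pos hε hX hV) h1
  simp only [argsFarR, argsFar]
  exact .cons (mem_sub hX (ht 4)) (.cons (mem_sub hX (ht 3)) (.cons (mem_sub hX (ht 5))
    (.cons (mem_add hXZ1 (mem_mul SC_pos hε (mem_sub (ht 6) (ht 0)) hV)) (.cons (mem_sub (ht 0) hX)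
    (.cons (mem_sub (mem_add (mem_add (ht 3) (ht 4)) (ht 5)) hX) (.cons hXZ1
    (.cons (mem_sub h1 (mem_mul SC_pos hε (ht 7) hV)) (.cons (mem_sub h1 (mem_mul SC_pos hε (ht 2) hV))
    (.cons (mem_sub h1 (mem_mul SC_pos hε (ht 1) hV))
    (.cons (mem_sub (mem_mul SC_pos hε (mem_add (mem_add (ht 1) (ht 2)) (ht 7)) hV) h1)
    (.cons (mem_sub (mem_mul SC_pos hε (ht 0) hV) h1) .nil)))))))))))

/-- The constant-term forms enclose the constant terms. -/
theorem constTerms_forall₂ (ht : ∀ i, mem SC ε (t i) (tA i)) :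
    List.Forall₂ (fun r F => mem SC ε r.1 F.1 ∧ mem SC ε r.2 F.2) (constTermsR t) (constTerms tA) := by
  simp only [constTermsR, constTerms]
  exact .cons ⟨mem_sub (ht 0) (ht 3), mem_sub (ht 0) (ht 3)⟩ (.cons ⟨mem_add (ht 3) (ht 4), mem_add (ht 3) (ht 4)⟩
    (.cons ⟨mem_add (ht 1) (ht 2), mem_add (ht 1) (ht 2)⟩ (.cons ⟨mem_sub (ht 0) (ht 2), mem_sub (ht 0) (ht 2)⟩
    (.cons ⟨mem_neg (mem_add (ht 4) (ht 6)), mem_add (ht 4) (ht 6)⟩ (.cons ⟨mem_neg (mem_sub (ht 0) (ht 6)), mem_sub (ht 0) (ht 6)⟩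
    (.cons ⟨mem_neg (mem_add (ht 1) (ht 6)), mem_add (ht 1) (ht 6)⟩ .nil))))))

end Mem

/-- Zipping two `Forall₂` relations into the product relation. -/
theorem forall₂_zip {α β γ δ : Type*} {P : α → γ → Prop} {Q : β → δ → Prop} {l₁ : List α} {l₂ : List β}
    {m₁ : List γ} {m₂ : List δ} (h₁ : List.Forall₂ P l₁ m₁) (h₂ : List.Forall₂ Q l₂ m₂) :
    List.Forall₂ (fun r F => P r.1 F.1 ∧ Q r.2 F.2) (l₁.zip l₂) (m₁.zip m₂) := by
  induction h₁ generalizing l₂ m₂ with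
  | nil => simp
  | cons hab _ ih =>
    cases h₂ with
    | nil => simp
    | cons hcd h₂' => exact .cons ⟨hab, hcd⟩ (ih h₂')

/-- **Near chart**: the growth functional at `(X + t₆, Y + t₆)` as the (12 + 7)-term sum over the real lists. -/
theorem growthLogR_near (t : Fin 8 → ℝ) (X Y : ℝ) :
    growthLogR (pR (aOfS t)) (qR (aOfS t)) (X + t 6) (Y + t 6)
      = ((((coefsR t).zip (argsNearR t X Y)) ++ constTermsR t).map fun r => r.1 * Real.log |r.2|).sum := by
  rw [growthLogR_aOfS]
  simp only [coefsR, argsNearR, constTermsR, List.zip_cons_cons, List.zip_nil_right, List.cons_append,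
    List.nil_append, List.map_cons, List.map_nil, List.sum_cons, List.sum_nil, Real.log_abs]
  ring_nf

/-- **The far-chart cancellation** (why `log|Z|` never appears): the seven exponents of the `y`-dependent arguments
of the growth functional (`e₄, e₇, …, e₁₂` of `growthLogR_aOfS`, here the entries 3 and 6–11 of `coefsR`) sum to
ZERO identically, so `Σ e_k·log|num_k/Z| = Σ e_k·log|num_k|` in the chart `Y = 1/Z`. -/
theorem yExponents_sum_eq_zero (t : Fin 8 → ℝ) :
    (t 0 + t 6) + (-2 * t 6) + (t 6 + t 7) + (t 2 + t 6) + (t 1 + t 6) + (-(t 1 + t 2 + (t 6 + t 7)))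
      + (-(t 0 + t 6)) = 0 := by
  ring

/-- **Far chart**: with `Z ≠ 0` and the seven numerators non-zero, the growth functional at `(X + t₆, 1/Z + t₆)` is
the sum over the far lists — the `log|Z|` contributions cancel because the seven `y`-exponents sum to zero. -/
theorem growthLogR_far (t : Fin 8 → ℝ) (X : ℝ) {Z : ℝ} (hZ : Z ≠ 0) (hnum : ∀ r ∈ argsFarR t X Z, r ≠ 0) :
    growthLogR (pR (aOfS t)) (qR (aOfS t)) (X + t 6) (Z⁻¹ + t 6)
      = ((((coefsR t).zip (argsFarR t X Z)) ++ constTermsR t).map fun r => r.1 * Real.log |r.2|).sum := by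
  simp only [argsFarR, List.mem_cons, List.mem_nil_iff, or_false, forall_eq_or_imp, forall_eq] at hnum
  obtain ⟨_, _, _, h3, _, _, h6, h7, h8, h9, h10, h11⟩ := hnum
  have lz := Real.log_abs Z
  -- each `y`-argument is `numerator / Z`
  have e3 : X + t 6 + (Z⁻¹ + t 6) - (t 0 + t 6) = (X * Z + 1 + (t 6 - t 0) * Z) / Z := by field_simp; ring
  have e6 : X + t 6 + (Z⁻¹ + t 6) - 2 * t 6 = (X * Z + 1) / Z := by field_simp; ring
  have e7 : Z⁻¹ + t 6 - (t 6 + t 7) = (1 - t 7 * Z) / Z := by field_simp; ring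
  have e8 : Z⁻¹ + t 6 - (t 2 + t 6) = (1 - t 2 * Z) / Z := by field_simp; ring
  have e9 : Z⁻¹ + t 6 - (t 1 + t 6) = (1 - t 1 * Z) / Z := by field_simp; ring
  have e10 : t 1 + t 2 + t 6 + t 7 - (Z⁻¹ + t 6) = ((t 1 + t 2 + t 7) * Z - 1) / Z := by field_simp; ring
  have e11 : t 0 + t 6 - (Z⁻¹ + t 6) = (t 0 * Z - 1) / Z := by field_simp; ring
  rw [growthLogR_aOfS, e3, e6, e7, e8, e9, e10, e11]
  simp only [← Real.log_abs (_ / Z), abs_div]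
  rw [Real.log_div (abs_ne_zero.2 h3) (abs_ne_zero.2 hZ), Real.log_div (abs_ne_zero.2 h6) (abs_ne_zero.2 hZ),
    Real.log_div (abs_ne_zero.2 h7) (abs_ne_zero.2 hZ), Real.log_div (abs_ne_zero.2 h8) (abs_ne_zero.2 hZ),
    Real.log_div (abs_ne_zero.2 h9) (abs_ne_zero.2 hZ), Real.log_div (abs_ne_zero.2 h10) (abs_ne_zero.2 hZ),
    Real.log_div (abs_ne_zero.2 h11) (abs_ne_zero.2 hZ)]
  simp only [coefsR, argsFarR, constTermsR, List.zip_cons_cons, List.zip_nil_right, List.cons_append,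
    List.nil_append, List.map_cons, List.map_nil, List.sum_cons, List.sum_nil, Real.log_abs]
  ring_nf

/-- In the near chart the twelve arguments ARE the twelve `critFactors`. -/
theorem critFactors_near (t : Fin 8 → ℝ) (X Y : ℝ) (k : Fin 12) :
    critFactors (pR (aOfS t)) (qR (aOfS t)) (X + t 6) (Y + t 6) k = (argsNearR t X Y).getD k 0 := by
  rw [critFactors_aOfS]
  fin_cases k <;> simp [argsNearR] <;> ring

/-- In the far chart (`Z ≠ 0`) each `critFactor` is the corresponding far argument, divided by `Z` for the seven
`y`-factors; so non-vanishing numerators give non-vanishing factors. -/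
theorem critFactors_far_ne_zero (t : Fin 8 → ℝ) (X : ℝ) {Z : ℝ} (hZ : Z ≠ 0) (hnum : ∀ r ∈ argsFarR t X Z, r ≠ 0)
    (k : Fin 12) : critFactors (pR (aOfS t)) (qR (aOfS t)) (X + t 6) (Z⁻¹ + t 6) k ≠ 0 := by
  simp only [argsFarR, List.mem_cons, List.mem_nil_iff, or_false, forall_eq_or_imp, forall_eq] at hnum
  obtain ⟨h0, h1, h2, h3, h4, h5, h6, h7, h8, h9, h10, h11⟩ := hnum
  rw [critFactors_aOfS]
  fin_cases k
  · simpa [sub_eq_zero] using fun h => h0 (by linarith)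
  · simpa [sub_eq_zero] using fun h => h1 (by linarith)
  · simpa [sub_eq_zero] using fun h => h2 (by linarith)
  · simp only [Fin.reduceFinMk, Matrix.cons_val]
    rw [show X + t 6 + (Z⁻¹ + t 6) - (t 0 + t 6) = (X * Z + 1 + (t 6 - t 0) * Z) / Z by field_simp; ring]
    exact div_ne_zero h3 hZ
  · simpa [sub_eq_zero] using fun h => h4 (by linarith)
  · simpa [sub_eq_zero] using fun h => h5 (by linarith)
  · simp only [Fin.reduceFinMk, Matrix.cons_val]
    rw [show X + t 6 + (Z⁻¹ + t 6) - 2 * t 6 = (X * Z + 1) / Z by field_simp; ring]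
    exact div_ne_zero h6 hZ
  · simp only [Fin.reduceFinMk, Matrix.cons_val]
    rw [show Z⁻¹ + t 6 - (t 6 + t 7) = (1 - t 7 * Z) / Z by field_simp; ring]
    exact div_ne_zero h7 hZ
  · simp only [Fin.reduceFinMk, Matrix.cons_val]
    rw [show Z⁻¹ + t 6 - (t 2 + t 6) = (1 - t 2 * Z) / Z by field_simp; ring]
    exact div_ne_zero h8 hZ
  · simp only [Fin.reduceFinMk, Matrix.cons_val]
    rw [show Z⁻¹ + t 6 - (t 1 + t 6) = (1 - t 1 * Z) / Z by field_simp; ring]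
    exact div_ne_zero h9 hZ
  · simp only [Fin.reduceFinMk, Matrix.cons_val]
    rw [show t 1 + t 2 + t 6 + t 7 - (Z⁻¹ + t 6) = ((t 1 + t 2 + t 7) * Z - 1) / Z by field_simp; ring]
    exact div_ne_zero h10 hZ
  · simp only [Fin.reduceFinMk, Matrix.cons_val]
    rw [show t 0 + t 6 - (Z⁻¹ + t 6) = (t 0 * Z - 1) / Z by field_simp; ring]
    exact div_ne_zero h11 hZ

end CritBox

end Summit.KontsevichZagierPeriods.Zeta5Search.Barrier.ConeGamma

end
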